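import Summits.BirchSwinnertonDyer.BirchSwinnertonDyer.Theorems.TwoAdicConverseTwoTorsionIsogenyPairsSemistable
import HarnessLib

/-!
# Route `TwoAdicConverse` (rung S3), items 19218 / 19219 and the leaf: stratum (β) = A₁ ⊔ A₂ ⊔ A₃ — the (β) piece of
# the leaf and of item 19218 from the three ATOMS (member-level case split; proofs only)

Cell `bsd-2adic` (run/shared/lean/pub/bsd-2adic/), seat `bsd-2adic-conv-1` (GEN 20).  THEOREMS ONLY — no
definition, no named fact, no `sorry`; `--supports stmt-BirchSwinnertonDyer-19218`.  HONEST FRAMING: BSD is not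
proved by any of this; item 19218 and its research inputs stay OPEN; nothing is booked.  PARTITION (D-0054): none —
RANK axis (S3), stratum (β) «`E(ℚ)[2] ≠ 0`» at a good-ordinary OR multiplicative `2`.

The companion files `TwoAdicConverseTwoTorsionPairTypes` (this GEN) and the Literature file
`Greenberg1999/TwoTorsionQuadraticTwistPairTypeProofs` show that the `ℤ/2`-linked pairs of stratum (β) come in four
types R₁ / M₁ / R₂ / M₂ and that the admissible twists `d ≡ 1 (mod 4)` preserve R₁, M₁ and mix R₂ with M₂.  At the
level of MEMBERS this gives three atoms, each closed under the pair and under the twists: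
A₁ = «`Δ < 0` with a ramified rational `2`-torsion point, or an unramified MIDDLE one» (the members of R₁ pairs),
A₂ = «`Δ < 0` with an unramified point, or a ramified MIDDLE one» (M₁), A₃ = «`Δ > 0` with an EXTREME (odd or
co-odd) point» (R₂ ∪ M₂).  Here: `atom_cases` (every rational `2`-torsion point lies in exactly one atom — a case
split on `sign Δ`, «ramified», and the real position), hence **the (β) piece of the `r ≤ 1` LEAF on
`GoodOrd W 2 ∨ Mult W 2` ⇐ the leaf on A₁ ∧ on A₂ ∧ on A₃** (`semistable_twoTorsion_leaf_of_atoms`, conclusion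
VERBATIM the `h2t` binder of `leaf_offBigImage_of_strata`), GEN 18's `hβ` (`goodOrd_twoTorsion_rankZero_of_atoms`),
and the leaf / item 19218 BY NAME (`nonCMTwoConverse_of_kolyvaginAtTwo_of_atoms_of_strata`,
`goodOrdinaryRankZeroTwoConverse_of_kolyvaginAtTwo_of_atoms`).

References: R. Greenberg, LNM 1716 (1999), §5 Props. 5.13–5.14 and Remarks pp. 120–124 [GreenbergLNM1716];
T. & V. Dokchitser, Math. Z. 272 (2012) 961–964 [DokchitserDokchitserMathZ2012]; W. Zhang, Camb. J. Math. 2 (2014)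
Thm. 1.1 (shape) [WZhang2014].
-/

set_option linter.dupNamespace false  -- `BirchSwinnertonDyer.BirchSwinnertonDyer` is the sub's path (D-0017)
set_option autoImplicit false

noncomputable section

open scoped Classical
open WeierstrassCurve Literature Literature.NumberTheory.EllipticCurves
  Literature.NumberTheory.EllipticCurves.ModularForms
  Literature.NumberTheory.EllipticCurves.Rank1Residual
  Literature.NumberTheory.EllipticCurves.Greenberg1999
  Summit.BirchSwinnertonDyer.BirchSwinnertonDyer.Theses.TwoAdicConverse
  Summit.BirchSwinnertonDyer.BirchSwinnertonDyer.Theorems.TwoAdicKolyvaginRankZero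

namespace Summit.BirchSwinnertonDyer.BirchSwinnertonDyer.Theorems.TwoAdicOffHabitat

variable (W : WeierstrassCurve ℚ) [W.IsElliptic] [W.IsGloballyMinimal]

/-! ## (β) = A₁ ⊔ A₂ ⊔ A₃: three atoms -/

omit [W.IsGloballyMinimal] in
/-- **The covering**: a rational point of order `2` on any `W/ℚ` falls in exactly one of the member-level atoms
A₁ «`Δ < 0` and ramified, or unramified middle», A₂ «`Δ < 0` and unramified, or ramified middle»,
A₃ «`Δ > 0` and extreme (odd or co-odd)» — a case split on `sign Δ`, «ramified» and the real position (at `Δ < 0` the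
point is the unique real one). [cite: GreenbergLNM1716, §5 Remarks (chunks p0170, p0174)] -/
theorem atom_cases (x : ℚ) :
    ((W.Δ < 0 ∧ TwoTorsionRamifiedAtTwo x) ∨ (¬ TwoTorsionRamifiedAtTwo x ∧ ¬ TwoTorsionOdd W x ∧
        ¬ ∀ r : ℝ, 4 * r ^ 3 + (W.b₂ : ℝ) * r ^ 2 + 2 * (W.b₄ : ℝ) * r + (W.b₆ : ℝ) = 0 → r ≤ (x : ℝ))) ∨
      ((W.Δ < 0 ∧ ¬ TwoTorsionRamifiedAtTwo x) ∨ (TwoTorsionRamifiedAtTwo x ∧ ¬ TwoTorsionOdd W x ∧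
        ¬ ∀ r : ℝ, 4 * r ^ 3 + (W.b₂ : ℝ) * r ^ 2 + 2 * (W.b₄ : ℝ) * r + (W.b₆ : ℝ) = 0 → r ≤ (x : ℝ))) ∨
      (0 < W.Δ ∧ (TwoTorsionOdd W x ∨
        ∀ r : ℝ, 4 * r ^ 3 + (W.b₂ : ℝ) * r ^ 2 + 2 * (W.b₄ : ℝ) * r + (W.b₆ : ℝ) = 0 → r ≤ (x : ℝ))) := by
  have hΔ0 : W.Δ ≠ 0 := by rw [← W.coe_Δ']; exact W.Δ'.ne_zero
  rcases lt_trichotomy W.Δ 0 with hl | he | hg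
  · by_cases hR : TwoTorsionRamifiedAtTwo x
    · exact Or.inl (Or.inl ⟨hl, hR⟩)
    · exact Or.inr (Or.inl (Or.inl ⟨hl, hR⟩))
  · exact absurd he hΔ0
  · by_cases hext : TwoTorsionOdd W x ∨
        ∀ r : ℝ, 4 * r ^ 3 + (W.b₂ : ℝ) * r ^ 2 + 2 * (W.b₄ : ℝ) * r + (W.b₆ : ℝ) = 0 → r ≤ (x : ℝ)
    · exact Or.inr (Or.inr ⟨hg, hext⟩)
    · rw [not_or] at hext
      by_cases hR : TwoTorsionRamifiedAtTwo x
      · exact Or.inr (Or.inl (Or.inr ⟨hR, hext.1, hext.2⟩))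
      · exact Or.inl (Or.inr ⟨hR, hext.1, hext.2⟩)

/-- **The (β) piece of the `r ≤ 1` LEAF on `GoodOrd W 2 ∨ Mult W 2` from the three atoms** (conclusion VERBATIM the
`h2t` binder of `leaf_offBigImage_of_strata`).  Each hypothesis is the leaf restricted to the curves carrying a
rational point of order `2` in the corresponding atom. [cite: GreenbergLNM1716, §5 Props. 5.13–5.14 and Remarks (chunks p0168–p0174)] -/
theorem semistable_twoTorsion_leaf_of_atoms
    (h₁ : ∀ (W : WeierstrassCurve ℚ) [W.IsElliptic] [W.IsGloballyMinimal], ¬ W.HasCM → (GoodOrd W 2 ∨ Mult W 2) →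
      (∃ x : ℚ, HasRationalTwoTorsionX W x ∧ ((W.Δ < 0 ∧ TwoTorsionRamifiedAtTwo x) ∨
        (¬ TwoTorsionRamifiedAtTwo x ∧ ¬ TwoTorsionOdd W x ∧
          ¬ ∀ r : ℝ, 4 * r ^ 3 + (W.b₂ : ℝ) * r ^ 2 + 2 * (W.b₄ : ℝ) * r + (W.b₆ : ℝ) = 0 → r ≤ (x : ℝ)))) →
      ∀ r : ℕ, r ≤ 1 → W.selmerCorank 2 = r → W.analyticRank = r)
    (h₂ : ∀ (W : WeierstrassCurve ℚ) [W.IsElliptic] [W.IsGloballyMinimal], ¬ W.HasCM → (GoodOrd W 2 ∨ Mult W 2) →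
      (∃ x : ℚ, HasRationalTwoTorsionX W x ∧ ((W.Δ < 0 ∧ ¬ TwoTorsionRamifiedAtTwo x) ∨
        (TwoTorsionRamifiedAtTwo x ∧ ¬ TwoTorsionOdd W x ∧
          ¬ ∀ r : ℝ, 4 * r ^ 3 + (W.b₂ : ℝ) * r ^ 2 + 2 * (W.b₄ : ℝ) * r + (W.b₆ : ℝ) = 0 → r ≤ (x : ℝ)))) →
      ∀ r : ℕ, r ≤ 1 → W.selmerCorank 2 = r → W.analyticRank = r)
    (h₃ : ∀ (W : WeierstrassCurve ℚ) [W.IsElliptic] [W.IsGloballyMinimal], ¬ W.HasCM → (GoodOrd W 2 ∨ Mult W 2) →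
      (∃ x : ℚ, HasRationalTwoTorsionX W x ∧ 0 < W.Δ ∧ (TwoTorsionOdd W x ∨
          ∀ r : ℝ, 4 * r ^ 3 + (W.b₂ : ℝ) * r ^ 2 + 2 * (W.b₄ : ℝ) * r + (W.b₆ : ℝ) = 0 → r ≤ (x : ℝ))) →
      ∀ r : ℕ, r ≤ 1 → W.selmerCorank 2 = r → W.analyticRank = r) :
    ∀ (W : WeierstrassCurve ℚ) [W.IsElliptic] [W.IsGloballyMinimal], ¬ W.HasCM →
      (GoodOrd W 2 ∨ Mult W 2) → (∃ P : W.toAffine.Point, P ≠ 0 ∧ 2 • P = 0) →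
      ∀ r : ℕ, r ≤ 1 → W.selmerCorank 2 = r → W.analyticRank = r := by
  intro W _ _ hCM hred hP r hr hc
  obtain ⟨x₀, y₀, hEq, h2⟩ := (exists_two_torsion_iff_exists_hasRationalTwoTorsionX W).mp hP
  have hx : HasRationalTwoTorsionX W x₀ := ⟨y₀, hEq, h2⟩
  rcases atom_cases W x₀ with h | h | h
  · exact h₁ W hCM hred ⟨x₀, hx, h⟩ r hr hc
  · exact h₂ W hCM hred ⟨x₀, hx, h⟩ r hr hc
  · exact h₃ W hCM hred ⟨x₀, hx, h⟩ r hr hc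

/-- **GEN 18's `hβ` (good ordinary, `r = 0`) from the three atoms.** [cite: GreenbergLNM1716, §5 Props. 5.13–5.14 and Remarks (chunks p0168–p0174)] -/
theorem goodOrd_twoTorsion_rankZero_of_atoms
    (h₁ : ∀ (W : WeierstrassCurve ℚ) [W.IsElliptic] [W.IsGloballyMinimal], ¬ W.HasCM → GoodOrd W 2 →
      (∃ x : ℚ, HasRationalTwoTorsionX W x ∧ ((W.Δ < 0 ∧ TwoTorsionRamifiedAtTwo x) ∨
        (¬ TwoTorsionRamifiedAtTwo x ∧ ¬ TwoTorsionOdd W x ∧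
          ¬ ∀ r : ℝ, 4 * r ^ 3 + (W.b₂ : ℝ) * r ^ 2 + 2 * (W.b₄ : ℝ) * r + (W.b₆ : ℝ) = 0 → r ≤ (x : ℝ)))) →
      W.selmerCorank 2 = 0 → W.analyticRank = 0)
    (h₂ : ∀ (W : WeierstrassCurve ℚ) [W.IsElliptic] [W.IsGloballyMinimal], ¬ W.HasCM → GoodOrd W 2 →
      (∃ x : ℚ, HasRationalTwoTorsionX W x ∧ ((W.Δ < 0 ∧ ¬ TwoTorsionRamifiedAtTwo x) ∨
        (TwoTorsionRamifiedAtTwo x ∧ ¬ TwoTorsionOdd W x ∧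
          ¬ ∀ r : ℝ, 4 * r ^ 3 + (W.b₂ : ℝ) * r ^ 2 + 2 * (W.b₄ : ℝ) * r + (W.b₆ : ℝ) = 0 → r ≤ (x : ℝ)))) →
      W.selmerCorank 2 = 0 → W.analyticRank = 0)
    (h₃ : ∀ (W : WeierstrassCurve ℚ) [W.IsElliptic] [W.IsGloballyMinimal], ¬ W.HasCM → GoodOrd W 2 →
      (∃ x : ℚ, HasRationalTwoTorsionX W x ∧ 0 < W.Δ ∧ (TwoTorsionOdd W x ∨
          ∀ r : ℝ, 4 * r ^ 3 + (W.b₂ : ℝ) * r ^ 2 + 2 * (W.b₄ : ℝ) * r + (W.b₆ : ℝ) = 0 → r ≤ (x : ℝ))) →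
      W.selmerCorank 2 = 0 → W.analyticRank = 0) :
    ∀ (W : WeierstrassCurve ℚ) [W.IsElliptic] [W.IsGloballyMinimal], ¬ W.HasCM → GoodOrd W 2 →
      (∃ P : W.toAffine.Point, P ≠ 0 ∧ 2 • P = 0) → W.selmerCorank 2 = 0 → W.analyticRank = 0 := by
  intro W _ _ hCM hgo hP hc
  obtain ⟨x₀, y₀, hEq, h2⟩ := (exists_two_torsion_iff_exists_hasRationalTwoTorsionX W).mp hP
  have hx : HasRationalTwoTorsionX W x₀ := ⟨y₀, hEq, h2⟩
  rcases atom_cases W x₀ with h | h | h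
  · exact h₁ W hCM hgo ⟨x₀, hx, h⟩ hc
  · exact h₂ W hCM hgo ⟨x₀, hx, h⟩ hc
  · exact h₃ W hCM hgo ⟨x₀, hx, h⟩ hc

/-- **The rung leaf from Kolyvagin at `2` on the habitat (S3 items 24622 V1′ + 24623 V2♭ + 24405 + 23951 + BFH + GZK)
and the off-habitat strata with (β) split into the three ATOMS.**  Every binder is a research statement or a printed
fact displayed by name; BSD is not proved by this. [cite: WZhang2014, Thm. 1.1 (shape at p ≥ 5)]
[cite: GreenbergLNM1716, §5 Props. 5.13–5.14 (chunks p0168–p0174)] [cite: DokchitserDokchitserMathZ2012, Theorem (1)–(3)] -/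
theorem nonCMTwoConverse_of_kolyvaginAtTwo_of_atoms_of_strata
    (hV1 : KolyvaginNonvanishingAtTwoFrame) (hV2 : KolyvaginCorankLowerBoundAtTwo)
    (hT : Summit.BirchSwinnertonDyer.BirchSwinnertonDyer.Theses.TwoAdicConverse.NoTwoTorsionOverK)
    (hIn : Summit.BirchSwinnertonDyer.BirchSwinnertonDyer.Theses.TwoAdicConverse.PrintedInputsRankOneAtTwo)
    (hBFH : bumpFriedbergHoffstein_exists_heegnerField_split_twist_simpleZero)
    (hGZK : rank_eq_analyticRank_of_analyticRank_le_one)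
    (h₁ : ∀ (W : WeierstrassCurve ℚ) [W.IsElliptic] [W.IsGloballyMinimal], ¬ W.HasCM → (GoodOrd W 2 ∨ Mult W 2) →
      (∃ x : ℚ, HasRationalTwoTorsionX W x ∧ ((W.Δ < 0 ∧ TwoTorsionRamifiedAtTwo x) ∨
        (¬ TwoTorsionRamifiedAtTwo x ∧ ¬ TwoTorsionOdd W x ∧
          ¬ ∀ r : ℝ, 4 * r ^ 3 + (W.b₂ : ℝ) * r ^ 2 + 2 * (W.b₄ : ℝ) * r + (W.b₆ : ℝ) = 0 → r ≤ (x : ℝ)))) →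
      ∀ r : ℕ, r ≤ 1 → W.selmerCorank 2 = r → W.analyticRank = r)
    (h₂ : ∀ (W : WeierstrassCurve ℚ) [W.IsElliptic] [W.IsGloballyMinimal], ¬ W.HasCM → (GoodOrd W 2 ∨ Mult W 2) →
      (∃ x : ℚ, HasRationalTwoTorsionX W x ∧ ((W.Δ < 0 ∧ ¬ TwoTorsionRamifiedAtTwo x) ∨
        (TwoTorsionRamifiedAtTwo x ∧ ¬ TwoTorsionOdd W x ∧
          ¬ ∀ r : ℝ, 4 * r ^ 3 + (W.b₂ : ℝ) * r ^ 2 + 2 * (W.b₄ : ℝ) * r + (W.b₆ : ℝ) = 0 → r ≤ (x : ℝ)))) →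
      ∀ r : ℕ, r ≤ 1 → W.selmerCorank 2 = r → W.analyticRank = r)
    (h₃ : ∀ (W : WeierstrassCurve ℚ) [W.IsElliptic] [W.IsGloballyMinimal], ¬ W.HasCM → (GoodOrd W 2 ∨ Mult W 2) →
      (∃ x : ℚ, HasRationalTwoTorsionX W x ∧ 0 < W.Δ ∧ (TwoTorsionOdd W x ∨
          ∀ r : ℝ, 4 * r ^ 3 + (W.b₂ : ℝ) * r ^ 2 + 2 * (W.b₄ : ℝ) * r + (W.b₆ : ℝ) = 0 → r ≤ (x : ℝ))) →
      ∀ r : ℕ, r ≤ 1 → W.selmerCorank 2 = r → W.analyticRank = r)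
    (h2c : ∀ (W : WeierstrassCurve ℚ) [W.IsElliptic] [W.IsGloballyMinimal], ¬ W.HasCM →
      (GoodOrd W 2 ∨ Mult W 2) → (∀ P : W.toAffine.Point, 2 • P = 0 → P = 0) →
      ¬ W.HasSurjectiveModNGaloisRep 2 → ∀ r : ℕ, r ≤ 1 → W.selmerCorank 2 = r → W.analyticRank = r)
    (h4 : ∀ (W : WeierstrassCurve ℚ) [W.IsElliptic] [W.IsGloballyMinimal], ¬ W.HasCM →
      (GoodOrd W 2 ∨ Mult W 2) → W.HasSurjectiveModNGaloisRep 2 → ¬ W.HasSurjectiveModNGaloisRep 4 →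
      ∀ r : ℕ, r ≤ 1 → W.selmerCorank 2 = r → W.analyticRank = r)
    (h8 : ∀ (W : WeierstrassCurve ℚ) [W.IsElliptic] [W.IsGloballyMinimal], ¬ W.HasCM →
      (GoodOrd W 2 ∨ Mult W 2) → W.HasSurjectiveModNGaloisRep 4 → ¬ W.HasSurjectiveModNGaloisRep 8 →
      ∀ r : ℕ, r ≤ 1 → W.selmerCorank 2 = r → W.analyticRank = r) :
    Summit.BirchSwinnertonDyer.BirchSwinnertonDyer.Rank1Residual.NonCMTwoConverse :=
  nonCMTwoConverse_of_kolyvaginAtTwo_of_strata hV1 hV2 hT hIn hBFH hGZK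
    (semistable_twoTorsion_leaf_of_atoms h₁ h₂ h₃) h2c h4 h8

/-- **Item 19218 `GoodOrdinaryRankZeroTwoConverse` BY NAME from Kolyvagin at `2` on the habitat (V1′ 24622 + V2♭ 24623 +
24405 + PRINT, conv-1 GEN 17 p607060), the three (β)-ATOMS, and the strata (γ₁), (γ₂).**  The route decl, fully
qualified; nothing here is unconditional. [cite: WZhang2014, Thm. 1.1 (shape at p ≥ 5)]
[cite: GreenbergLNM1716, §5 Props. 5.13–5.14 (chunks p0168–p0174)] [cite: DokchitserDokchitserMathZ2012, Theorem (1)–(3) and Lemma] -/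
theorem goodOrdinaryRankZeroTwoConverse_of_kolyvaginAtTwo_of_atoms
    (hV1 : KolyvaginNonvanishingAtTwoFrame) (hV2 : KolyvaginCorankLowerBoundAtTwo)
    (hT : Summit.BirchSwinnertonDyer.BirchSwinnertonDyer.Theses.TwoAdicConverse.NoTwoTorsionOverK)
    (hmod : exists_isNewformOf)
    (hBFH : bumpFriedbergHoffstein_exists_heegnerField_split_twist_simpleZero)
    (hpar : ∀ (V : WeierstrassCurve ℚ) [V.IsElliptic], p_parity V 2)
    (hGZK : rank_eq_analyticRank_of_analyticRank_le_one)
    (hE : WeierstrassCurve.hasEntireLFunction_rat)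
    (hGZ : ∀ (V : WeierstrassCurve ℚ) (N : ℕ) [NeZero N] (K : Type) [Field K] [NumberField K],
      analyticRankEK_eq_one_iff_heegner_nonTorsion V N K)
    (hrec : ∀ (N : ℕ) [NeZero N] (V : WeierstrassCurve ℚ) (K : Type) [Field K] [NumberField K],
      heegnerPointOfConductor_one_galoisConj N V K)
    (h₁ : ∀ (W : WeierstrassCurve ℚ) [W.IsElliptic] [W.IsGloballyMinimal], ¬ W.HasCM → GoodOrd W 2 →
      (∃ x : ℚ, HasRationalTwoTorsionX W x ∧ ((W.Δ < 0 ∧ TwoTorsionRamifiedAtTwo x) ∨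
        (¬ TwoTorsionRamifiedAtTwo x ∧ ¬ TwoTorsionOdd W x ∧
          ¬ ∀ r : ℝ, 4 * r ^ 3 + (W.b₂ : ℝ) * r ^ 2 + 2 * (W.b₄ : ℝ) * r + (W.b₆ : ℝ) = 0 → r ≤ (x : ℝ)))) →
      W.selmerCorank 2 = 0 → W.analyticRank = 0)
    (h₂ : ∀ (W : WeierstrassCurve ℚ) [W.IsElliptic] [W.IsGloballyMinimal], ¬ W.HasCM → GoodOrd W 2 →
      (∃ x : ℚ, HasRationalTwoTorsionX W x ∧ ((W.Δ < 0 ∧ ¬ TwoTorsionRamifiedAtTwo x) ∨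
        (TwoTorsionRamifiedAtTwo x ∧ ¬ TwoTorsionOdd W x ∧
          ¬ ∀ r : ℝ, 4 * r ^ 3 + (W.b₂ : ℝ) * r ^ 2 + 2 * (W.b₄ : ℝ) * r + (W.b₆ : ℝ) = 0 → r ≤ (x : ℝ)))) →
      W.selmerCorank 2 = 0 → W.analyticRank = 0)
    (h₃ : ∀ (W : WeierstrassCurve ℚ) [W.IsElliptic] [W.IsGloballyMinimal], ¬ W.HasCM → GoodOrd W 2 →
      (∃ x : ℚ, HasRationalTwoTorsionX W x ∧ 0 < W.Δ ∧ (TwoTorsionOdd W x ∨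
          ∀ r : ℝ, 4 * r ^ 3 + (W.b₂ : ℝ) * r ^ 2 + 2 * (W.b₄ : ℝ) * r + (W.b₆ : ℝ) = 0 → r ≤ (x : ℝ))) →
      W.selmerCorank 2 = 0 → W.analyticRank = 0)
    (hγ₁ : ∀ (W : WeierstrassCurve ℚ) [W.IsElliptic] [W.IsGloballyMinimal], ¬ W.HasCM → GoodOrd W 2 →
      (∀ P : W.toAffine.Point, 2 • P = 0 → P = 0) → IsSquare W.Δ →
      W.selmerCorank 2 = 0 → W.analyticRank = 0)
    (hγ₂ : ∀ (W : WeierstrassCurve ℚ) [W.IsElliptic] [W.IsGloballyMinimal], ¬ W.HasCM → GoodOrd W 2 →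
      W.HasSurjectiveModNGaloisRep 2 → IsSquare (-W.Δ) →
      W.selmerCorank 2 = 0 → W.analyticRank = 0) :
    Summit.BirchSwinnertonDyer.BirchSwinnertonDyer.Theses.TwoAdicConverse.GoodOrdinaryRankZeroTwoConverse :=
  goodOrdinaryRankZeroTwoConverse_of_kolyvaginAtTwo_of_three_strata hV1 hV2 hT hmod hBFH hpar hGZK hE hGZ hrec
    (goodOrd_twoTorsion_rankZero_of_atoms h₁ h₂ h₃) hγ₁ hγ₂

/-! ## (GEN 20, second pass) The `r = 1` residual 24404 `RankOneTwoConverseOffBigImage` in atom currency -/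

/-- **S3's `r = 1` residual item 24404 `RankOneTwoConverseOffBigImage` BY NAME from its LEVEL strata at `r = 1` with (β) split into
the three atoms**: A₁ / A₂ / A₃ (rational `2`-torsion), (S2c) `C₃` image, (S4) onto mod `2` not mod `4`, (S8) onto mod `4` not mod `8`
— each for `corank = 1 ⟹ r_an = 1` on `GoodOrd W 2 ∨ Mult W 2`.  The route decl, fully qualified; every binder is an open research
statement. [cite: DokchitserDokchitserMathZ2012, Theorem (1)–(3)] [cite: GreenbergLNM1716, §5 Props. 5.13–5.14 and Remarks (chunks p0168–p0174)] -/
theorem rankOneTwoConverseOffBigImage_of_atoms_of_strata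
    (h₁ : ∀ (W : WeierstrassCurve ℚ) [W.IsElliptic] [W.IsGloballyMinimal], ¬ W.HasCM → (GoodOrd W 2 ∨ Mult W 2) →
      (∃ x : ℚ, HasRationalTwoTorsionX W x ∧ ((W.Δ < 0 ∧ TwoTorsionRamifiedAtTwo x) ∨
        (¬ TwoTorsionRamifiedAtTwo x ∧ ¬ TwoTorsionOdd W x ∧
          ¬ ∀ r : ℝ, 4 * r ^ 3 + (W.b₂ : ℝ) * r ^ 2 + 2 * (W.b₄ : ℝ) * r + (W.b₆ : ℝ) = 0 → r ≤ (x : ℝ)))) →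
      W.selmerCorank 2 = 1 → W.analyticRank = 1)
    (h₂ : ∀ (W : WeierstrassCurve ℚ) [W.IsElliptic] [W.IsGloballyMinimal], ¬ W.HasCM → (GoodOrd W 2 ∨ Mult W 2) →
      (∃ x : ℚ, HasRationalTwoTorsionX W x ∧ ((W.Δ < 0 ∧ ¬ TwoTorsionRamifiedAtTwo x) ∨
        (TwoTorsionRamifiedAtTwo x ∧ ¬ TwoTorsionOdd W x ∧
          ¬ ∀ r : ℝ, 4 * r ^ 3 + (W.b₂ : ℝ) * r ^ 2 + 2 * (W.b₄ : ℝ) * r + (W.b₆ : ℝ) = 0 → r ≤ (x : ℝ)))) →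
      W.selmerCorank 2 = 1 → W.analyticRank = 1)
    (h₃ : ∀ (W : WeierstrassCurve ℚ) [W.IsElliptic] [W.IsGloballyMinimal], ¬ W.HasCM → (GoodOrd W 2 ∨ Mult W 2) →
      (∃ x : ℚ, HasRationalTwoTorsionX W x ∧ 0 < W.Δ ∧ (TwoTorsionOdd W x ∨
          ∀ r : ℝ, 4 * r ^ 3 + (W.b₂ : ℝ) * r ^ 2 + 2 * (W.b₄ : ℝ) * r + (W.b₆ : ℝ) = 0 → r ≤ (x : ℝ))) →
      W.selmerCorank 2 = 1 → W.analyticRank = 1)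
    (h2c : ∀ (W : WeierstrassCurve ℚ) [W.IsElliptic] [W.IsGloballyMinimal], ¬ W.HasCM →
      (GoodOrd W 2 ∨ Mult W 2) → (∀ P : W.toAffine.Point, 2 • P = 0 → P = 0) →
      ¬ W.HasSurjectiveModNGaloisRep 2 → W.selmerCorank 2 = 1 → W.analyticRank = 1)
    (h4 : ∀ (W : WeierstrassCurve ℚ) [W.IsElliptic] [W.IsGloballyMinimal], ¬ W.HasCM →
      (GoodOrd W 2 ∨ Mult W 2) → W.HasSurjectiveModNGaloisRep 2 → ¬ W.HasSurjectiveModNGaloisRep 4 →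
      W.selmerCorank 2 = 1 → W.analyticRank = 1)
    (h8 : ∀ (W : WeierstrassCurve ℚ) [W.IsElliptic] [W.IsGloballyMinimal], ¬ W.HasCM →
      (GoodOrd W 2 ∨ Mult W 2) → W.HasSurjectiveModNGaloisRep 4 → ¬ W.HasSurjectiveModNGaloisRep 8 →
      W.selmerCorank 2 = 1 → W.analyticRank = 1) :
    Summit.BirchSwinnertonDyer.BirchSwinnertonDyer.Theses.TwoAdicConverse.RankOneTwoConverseOffBigImage := by
  intro W _ _ hCM hred hoff hc
  refine offHabitat_elim_strata hoff (fun hP ↦ ?_) (fun h h' ↦ h2c W hCM hred h h' hc) (fun h h' ↦ h4 W hCM hred h h' hc)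
    (fun h h' ↦ h8 W hCM hred h h' hc)
  obtain ⟨x₀, y₀, hEq, h2⟩ := (exists_two_torsion_iff_exists_hasRationalTwoTorsionX W).mp hP
  have hx : HasRationalTwoTorsionX W x₀ := ⟨y₀, hEq, h2⟩
  rcases atom_cases W x₀ with h | h | h
  · exact h₁ W hCM hred ⟨x₀, hx, h⟩ hc
  · exact h₂ W hCM hred ⟨x₀, hx, h⟩ hc
  · exact h₃ W hCM hred ⟨x₀, hx, h⟩ hc

end Summit.BirchSwinnertonDyer.BirchSwinnertonDyer.Theorems.TwoAdicOffHabitat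

end
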